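import Mathlib
import Summits.KontsevichZagierPeriods.KontsevichZagierPeriods.Theorems.SoloInformedHookPieces
import Summits.KontsevichZagierPeriods.KontsevichZagierPeriods.Theorems.SoloInformedShuffleLinExt
import HarnessLib
import HarnessLib.Audit

/-!
# SoloInformed — linear extensions of the hook poset are colourings (PROGRAMME LIII, file F5c)

Solo programme `solo-KontsevichZagierPeriods-informed`, session s54. Dimension
`n = (m + 1) + (i + 1)`; `E(m, i) = soloInformedHookPoset m i` is the hook poset (the chain
`x_0 > x_1 > ⋯ > x_m` on the first block, the bullets `y_0 < ⋯ < y_i` on the second block, and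
`y_i < x_0`). The moves of PROGRAMME XLII file 2 (`SoloInformedShuffleLinExt`, two chains), redone
for the hook: a permutation `σ` is a linear extension of `E(m, i)` iff its slot map
`P_σ = rev ∘ σ⁻¹` increases down the chain, decreases along the bullets (read from `y_i`) and puts
`x_0` first (`soloInformed_hookCompat_iff`); colouring slot `k` by "carries a chain coordinate"
(`soloInformedHookColour σ`) gives a colouring with `m + 1` slots `true`, slot `0` among them, and
this is a bijection (inverse `soloInformedHookSigma`, via `Finset.orderEmbOfFin`;
`soloInformed_eq_hookSigma`, `soloInformed_hookColour_hookSigma`); and — the point — the word read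
along `σ` (`soloInformedHookWordσ`, file F5b) is the interleaving `fill_{c(σ)}(bw(u), 1^{i+1})` of
XLII file 1 (`soloInformed_hookWordσ_eq_ofFn_fillC`). Colourings are indexed by
`Fin (m + 1 + i + 1)` (definitionally the ambient `Fin (m + 1 + (i + 1))`) so that the
`Fin (n + 1)` lemmas of XLII file 1 apply verbatim in file `SoloInformedHookShuffle`, which turns
the hook sum into the shuffle sum `∑_{w ∈ bw(u)⁻ ш 1^{i+1}} F (0 :: w)`.
References: Stanley 1986, *Two poset polytopes*, §1; Reutenauer 1993 §1.4;
Kaneko–Yamamoto 2018 (arXiv:1605.03117) §4; Kontsevich–Zagier 2001 §1.2 [KontsevichZagier2001].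
-/

noncomputable section

open Literature.NumberTheory.Transcendental
open Literature.NumberTheory.Transcendental.KZ

namespace Summit.KontsevichZagierPeriods.KontsevichZagierPeriods.Theorems

variable {m i : ℕ}

/-! ## 1. Linear extensions of the hook poset as slot maps -/

/-- **A permutation is a linear extension of the hook poset iff its slot map increases down the
chain, decreases along the bullets (`y_i` first) and puts `x_0` above `y_i`.** -/
theorem soloInformed_hookCompat_iff {σ : Equiv.Perm (Fin (m + 1 + (i + 1)))} :
    soloInformedCompat (soloInformedHookPoset m i) σ ↔
      StrictMono (fun j : Fin (m + 1) => soloInformedCellPerm σ (Fin.castAdd (i + 1) j)) ∧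
        StrictAnti (fun j : Fin (i + 1) => soloInformedCellPerm σ (Fin.natAdd (m + 1) j)) ∧
          soloInformedCellPerm σ (Fin.castAdd (i + 1) 0) <
            soloInformedCellPerm σ (Fin.natAdd (m + 1) (Fin.last i)) := by
  constructor
  · intro hσ
    refine ⟨Fin.strictMono_iff_lt_succ.2 fun j => ?_, Fin.strictAnti_iff_succ_lt.2 fun j => ?_, ?_⟩
    · exact soloInformed_hookCompat_lt hσ (soloInformed_mem_hookPoset_chain j)
    · exact soloInformed_hookCompat_lt hσ (soloInformed_mem_hookPoset_bullet j)
    · exact soloInformed_hookCompat_lt hσ soloInformed_mem_hookPoset_top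
  · rintro ⟨h1, h2, h3⟩ c hc
    unfold soloInformedHookPoset at hc
    rcases List.mem_append.1 hc with hc | hc
    · obtain ⟨j, -, rfl⟩ := List.mem_map.1 hc
      rw [soloInformed_symm_apply_eq_rev_cellPerm, soloInformed_symm_apply_eq_rev_cellPerm,
        Fin.rev_lt_rev]
      exact h1 (Fin.castSucc_lt_succ (i := j))
    · rcases List.mem_cons.1 hc with rfl | hc
      · rw [soloInformed_symm_apply_eq_rev_cellPerm, soloInformed_symm_apply_eq_rev_cellPerm,
          Fin.rev_lt_rev]
        exact h3
      · obtain ⟨j, -, rfl⟩ := List.mem_map.1 hc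
        rw [soloInformed_symm_apply_eq_rev_cellPerm, soloInformed_symm_apply_eq_rev_cellPerm,
          Fin.rev_lt_rev]
        exact h2 (Fin.castSucc_lt_succ (i := j))

/-! ## 2. The colouring of a linear extension -/

/-- The slot colouring of `σ`: slot `k` is `true` iff it carries a chain coordinate `x_j`.
(Slots are indexed by `Fin (m + 1 + i + 1)`, definitionally the ambient `Fin (m + 1 + (i + 1))`.) -/
def soloInformedHookColour (σ : Equiv.Perm (Fin (m + 1 + (i + 1)))) (k : Fin (m + 1 + i + 1)) :
    Bool :=
  decide ((((soloInformedCellPerm σ).symm k : Fin (m + 1 + (i + 1))) : ℕ) < m + 1)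

/-- Slots of chain coordinates are `true`. -/
theorem soloInformed_hookColour_cellPerm_castAdd (σ : Equiv.Perm (Fin (m + 1 + (i + 1))))
    (j : Fin (m + 1)) :
    soloInformedHookColour σ (soloInformedCellPerm σ (Fin.castAdd (i + 1) j)) = true := by
  simp only [soloInformedHookColour, Equiv.symm_apply_apply, Fin.val_castAdd, decide_eq_true_eq]
  exact j.isLt

/-- Slots of bullet coordinates are `false`. -/
theorem soloInformed_hookColour_cellPerm_natAdd (σ : Equiv.Perm (Fin (m + 1 + (i + 1))))
    (j : Fin (i + 1)) :
    soloInformedHookColour σ (soloInformedCellPerm σ (Fin.natAdd (m + 1) j)) = false := by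
  simp only [soloInformedHookColour, Equiv.symm_apply_apply, Fin.val_natAdd, decide_eq_false_iff_not]
  omega

/-- The `true` slots are exactly the slots of the chain. -/
theorem soloInformed_hookColour_eq_true_iff (σ : Equiv.Perm (Fin (m + 1 + (i + 1))))
    (k : Fin (m + 1 + (i + 1))) :
    soloInformedHookColour σ k = true ↔
      ∃ j : Fin (m + 1), k = soloInformedCellPerm σ (Fin.castAdd (i + 1) j) := by
  constructor
  · intro h
    obtain ⟨x, rfl⟩ : ∃ x, k = soloInformedCellPerm σ x :=
      ⟨(soloInformedCellPerm σ).symm k, ((soloInformedCellPerm σ).apply_symm_apply k).symm⟩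
    induction x using Fin.addCases with
    | left j => exact ⟨j, rfl⟩
    | right j =>
      rw [soloInformed_hookColour_cellPerm_natAdd] at h
      exact absurd h Bool.false_ne_true
  · rintro ⟨j, rfl⟩
    exact soloInformed_hookColour_cellPerm_castAdd σ j

/-- The `false` slots are exactly the slots of the bullets. -/
theorem soloInformed_hookColour_eq_false_iff (σ : Equiv.Perm (Fin (m + 1 + (i + 1))))
    (k : Fin (m + 1 + (i + 1))) :
    soloInformedHookColour σ k = false ↔
      ∃ j : Fin (i + 1), k = soloInformedCellPerm σ (Fin.natAdd (m + 1) j) := by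
  constructor
  · intro h
    obtain ⟨x, rfl⟩ : ∃ x, k = soloInformedCellPerm σ x :=
      ⟨(soloInformedCellPerm σ).symm k, ((soloInformedCellPerm σ).apply_symm_apply k).symm⟩
    induction x using Fin.addCases with
    | left j =>
      rw [soloInformed_hookColour_cellPerm_castAdd] at h
      exact absurd h.symm Bool.false_ne_true
    | right j => exact ⟨j, rfl⟩
  · rintro ⟨j, rfl⟩
    exact soloInformed_hookColour_cellPerm_natAdd σ j

/-- The `false` slots, enumerated from the top bullet `y_i` down. -/
theorem soloInformed_hookColour_not_eq_true_iff (σ : Equiv.Perm (Fin (m + 1 + (i + 1))))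
    (k : Fin (m + 1 + (i + 1))) :
    (!soloInformedHookColour σ k) = true ↔
      ∃ j : Fin (i + 1), k = soloInformedCellPerm σ (Fin.natAdd (m + 1) (Fin.rev j)) := by
  rw [Bool.not_eq_true', soloInformed_hookColour_eq_false_iff]
  constructor
  · rintro ⟨j, hj⟩
    exact ⟨Fin.rev j, by rwa [Fin.rev_rev]⟩
  · rintro ⟨j, hj⟩
    exact ⟨Fin.rev j, hj⟩

/-- Exactly `m + 1` slots are `true`. -/
theorem soloInformed_countC_hookColour (σ : Equiv.Perm (Fin (m + 1 + (i + 1)))) :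
    soloInformedCountC (soloInformedHookColour σ) = m + 1 := by
  unfold soloInformedCountC
  have h : (Finset.univ.filter fun k => soloInformedHookColour σ k = true) =
      Finset.univ.image fun j : Fin (m + 1) => soloInformedCellPerm σ (Fin.castAdd (i + 1) j) := by
    ext k
    simp only [Finset.mem_filter, Finset.mem_univ, true_and, Finset.mem_image,
      soloInformed_hookColour_eq_true_iff]
    constructor
    · rintro ⟨j, hj⟩
      exact ⟨j, hj.symm⟩
    · rintro ⟨j, hj⟩
      exact ⟨j, hj.symm⟩
  have hinj : Function.Injective fun j : Fin (m + 1) =>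
      soloInformedCellPerm σ (Fin.castAdd (i + 1) j) := fun j j' hjj =>
    Fin.ext (by simpa using congrArg Fin.val ((soloInformedCellPerm σ).injective hjj))
  rw [h, Finset.card_image_of_injective _ hinj, Finset.card_univ, Fintype.card_fin]

/-- For a linear extension the top slot is `true` (it carries `x_0`). -/
theorem soloInformed_hookColour_zero {σ : Equiv.Perm (Fin (m + 1 + (i + 1)))}
    (hσ : soloInformedCompat (soloInformedHookPoset m i) σ) : soloInformedHookColour σ 0 = true := by
  have h := soloInformed_hookCompat_symm_zero hσ
  unfold soloInformedHookColour
  rw [decide_eq_true_eq]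
  have h' : (((soloInformedCellPerm σ).symm 0 : Fin (m + 1 + (i + 1))) : ℕ) =
      ((Fin.castAdd (i + 1) (0 : Fin (m + 1)) : Fin (m + 1 + (i + 1))) : ℕ) := congrArg Fin.val h
  rw [Fin.val_castAdd, Fin.val_zero] at h'
  exact h'.trans_lt (Nat.succ_pos m)

/-! ## 3. The word read along a linear extension is the interleaving of its colouring -/

/-- **WORD LEMMA (hook).** For a linear extension `σ`, the letter at slot `k` of the word read along
`σ` is the letter at `k` of the interleaving `fill_{c(σ)}(bw(u), 1^{i+1})`. -/
theorem soloInformed_hookLetter_eq_fillC {σ : Equiv.Perm (Fin (m + 1 + (i + 1)))}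
    (hσ : soloInformedCompat (soloInformedHookPoset m i) σ) (u : List ℕ)
    (k : Fin (m + 1 + (i + 1))) :
    soloInformedHookLetter u m i σ k =
      soloInformedFillC (soloInformedHookColour σ) (MZV.binaryWord u)
        (List.replicate (i + 1) true) k := by
  obtain ⟨h1, h2, -⟩ := soloInformed_hookCompat_iff.1 hσ
  obtain ⟨x, rfl⟩ : ∃ x, k = soloInformedCellPerm σ x :=
    ⟨(soloInformedCellPerm σ).symm k, ((soloInformedCellPerm σ).apply_symm_apply k).symm⟩
  unfold soloInformedHookLetter
  rw [Equiv.symm_apply_apply]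
  induction x using Fin.addCases with
  | left j =>
    rw [soloInformedHookEps_castAdd, soloInformedFillC,
      if_pos (soloInformed_hookColour_cellPerm_castAdd σ j),
      soloInformed_idxC_of_strictMono _ h1 (soloInformed_hookColour_eq_true_iff σ) j,
      soloInformedWordFn_apply]
  | right j =>
    have hf : ¬ soloInformedHookColour σ (soloInformedCellPerm σ (Fin.natAdd (m + 1) j)) = true := by
      rw [soloInformed_hookColour_cellPerm_natAdd]
      exact Bool.false_ne_true
    have hmono : StrictMono fun j' : Fin (i + 1) =>
        soloInformedCellPerm σ (Fin.natAdd (m + 1) (Fin.rev j')) :=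
      fun a b hab => h2 (Fin.rev_lt_rev.2 hab)
    have hidx := soloInformed_idxC_of_strictMono (fun k => !soloInformedHookColour σ k) hmono
      (soloInformed_hookColour_not_eq_true_iff σ) (Fin.rev j)
    rw [Fin.rev_rev] at hidx
    rw [soloInformedHookEps_natAdd, soloInformedFillC, if_neg hf, hidx,
      List.getD_eq_getElem _ _ (by rw [List.length_replicate]; exact (Fin.rev j).isLt),
      List.getElem_replicate]

/-- Hence the word read along `σ` is `fill_{c(σ)}(bw(u), 1^{i+1})`. -/
theorem soloInformed_hookWordσ_eq_ofFn_fillC {σ : Equiv.Perm (Fin (m + 1 + (i + 1)))}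
    (hσ : soloInformedCompat (soloInformedHookPoset m i) σ) (u : List ℕ) :
    soloInformedHookWordσ u m i σ =
      List.ofFn (soloInformedFillC (soloInformedHookColour σ) (MZV.binaryWord u)
        (List.replicate (i + 1) true)) := by
  unfold soloInformedHookWordσ
  exact congrArg List.ofFn (funext fun k => soloInformed_hookLetter_eq_fillC hσ u k)

/-! ## 4. The linear extension of a colouring -/

section Inverse

variable (c : Fin (m + 1 + i + 1) → Bool) (hc : soloInformedCountC c = m + 1)

/-- The complementary count. -/
theorem soloInformed_hookCountC_not_of (hc : soloInformedCountC c = m + 1) :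
    soloInformedCountC (fun k => !c k) = i + 1 := by
  have h := soloInformed_countC_add_countC_not c
  omega

/-- The slot map of a colouring: `x_j` goes to the `j`-th `true` slot, the bullet `y_j` to the
`(i - j)`-th `false` slot (the bullets are read from `y_i` down). -/
def soloInformedHookTau (hc : soloInformedCountC c = m + 1) :
    Fin (m + 1 + (i + 1)) → Fin (m + 1 + (i + 1)) :=
  Fin.append (fun j => (Finset.univ.filter fun k => c k = true).orderEmbOfFin hc j)
    (fun j => (Finset.univ.filter fun k => (!c k) = true).orderEmbOfFin
      (soloInformed_hookCountC_not_of c hc) (Fin.rev j))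

/-- Chain coordinates land on `true` slots. -/
theorem soloInformed_hookTau_castAdd (j : Fin (m + 1)) :
    c (soloInformedHookTau c hc (Fin.castAdd (i + 1) j)) = true := by
  have h := Finset.orderEmbOfFin_mem (Finset.univ.filter fun k => c k = true) hc j
  rw [Finset.mem_filter] at h
  simp only [soloInformedHookTau, Fin.append_left]
  exact h.2

/-- Bullet coordinates land on `false` slots. -/
theorem soloInformed_hookTau_natAdd (j : Fin (i + 1)) :
    c (soloInformedHookTau c hc (Fin.natAdd (m + 1) j)) = false := by
  have h := Finset.orderEmbOfFin_mem (Finset.univ.filter fun k => (!c k) = true)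
    (soloInformed_hookCountC_not_of c hc) (Fin.rev j)
  rw [Finset.mem_filter] at h
  simp only [soloInformedHookTau, Fin.append_right]
  simpa using h.2

/-- The slot map increases down the chain … -/
theorem soloInformed_hookTau_strictMono :
    StrictMono fun j : Fin (m + 1) => soloInformedHookTau c hc (Fin.castAdd (i + 1) j) := by
  intro j j' hjj
  simp only [soloInformedHookTau, Fin.append_left]
  exact (Finset.orderEmbOfFin _ hc).strictMono hjj

/-- … and decreases along the bullets. -/
theorem soloInformed_hookTau_strictAnti :
    StrictAnti fun j : Fin (i + 1) => soloInformedHookTau c hc (Fin.natAdd (m + 1) j) := by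
  intro j j' hjj
  simp only [soloInformedHookTau, Fin.append_right]
  exact (Finset.orderEmbOfFin _ _).strictMono (Fin.rev_lt_rev.2 hjj)

/-- The slot map is injective. -/
theorem soloInformed_hookTau_injective : Function.Injective (soloInformedHookTau c hc) := by
  intro x y hxy
  induction x using Fin.addCases with
  | left j =>
    induction y using Fin.addCases with
    | left j' =>
      exact congrArg (Fin.castAdd (i + 1)) ((soloInformed_hookTau_strictMono c hc).injective hxy)
    | right j' =>
      have h1 := soloInformed_hookTau_castAdd c hc j
      rw [hxy, soloInformed_hookTau_natAdd c hc] at h1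
      exact absurd h1 Bool.false_ne_true
  | right j =>
    induction y using Fin.addCases with
    | left j' =>
      have h1 := soloInformed_hookTau_castAdd c hc j'
      rw [← hxy, soloInformed_hookTau_natAdd c hc] at h1
      exact absurd h1 Bool.false_ne_true
    | right j' =>
      exact congrArg (Fin.natAdd (m + 1)) ((soloInformed_hookTau_strictAnti c hc).injective hxy)

/-- The slot map of a colouring as a permutation. -/
def soloInformedHookTauPerm (hc : soloInformedCountC c = m + 1) :
    Equiv.Perm (Fin (m + 1 + (i + 1))) :=
  Equiv.ofBijective (soloInformedHookTau c hc)
    (Finite.injective_iff_bijective.1 (soloInformed_hookTau_injective c hc))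

/-- The permutation acts as the slot map. -/
@[simp] theorem soloInformed_hookTauPerm_apply (x : Fin (m + 1 + (i + 1))) :
    soloInformedHookTauPerm c hc x = soloInformedHookTau c hc x := rfl

/-- **The linear extension of a colouring**: the permutation whose slot map is
`soloInformedHookTau`. -/
def soloInformedHookSigma (hc : soloInformedCountC c = m + 1) :
    Equiv.Perm (Fin (m + 1 + (i + 1))) :=
  Fin.revPerm.trans (soloInformedHookTauPerm c hc).symm

/-- Its slot map is the slot map of the colouring. -/
theorem soloInformed_cellPerm_hookSigma_apply (x : Fin (m + 1 + (i + 1))) :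
    soloInformedCellPerm (soloInformedHookSigma c hc) x = soloInformedHookTau c hc x := by
  simp [soloInformedCellPerm, soloInformedHookSigma]

/-- If slot `0` is `true`, the permutation is a linear extension of the hook poset. -/
theorem soloInformed_hookSigma_compat (hc0 : c 0 = true) :
    soloInformedCompat (soloInformedHookPoset m i) (soloInformedHookSigma c hc) := by
  rw [soloInformed_hookCompat_iff]
  simp only [soloInformed_cellPerm_hookSigma_apply]
  refine ⟨soloInformed_hookTau_strictMono c hc, soloInformed_hookTau_strictAnti c hc, ?_⟩
  have hmem : (0 : Fin (m + 1 + (i + 1))) ∈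
      Set.range ((Finset.univ.filter fun k => c k = true).orderEmbOfFin hc) := by
    rw [Finset.range_orderEmbOfFin, Finset.mem_coe, Finset.mem_filter]
    exact ⟨Finset.mem_univ _, hc0⟩
  obtain ⟨j0, hj0⟩ := hmem
  have h0 : soloInformedHookTau c hc (Fin.castAdd (i + 1) 0) = 0 := by
    simp only [soloInformedHookTau, Fin.append_left]
    refine le_antisymm ?_ (Fin.zero_le _)
    rw [← hj0]
    exact (Finset.orderEmbOfFin _ hc).monotone (Fin.zero_le j0)
  have hne : soloInformedHookTau c hc (Fin.natAdd (m + 1) (Fin.last i)) ≠ 0 := by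
    intro h
    have h1 := soloInformed_hookTau_natAdd c hc (Fin.last i)
    rw [h, hc0] at h1
    exact Bool.noConfusion h1
  rw [h0]
  exact lt_of_le_of_ne (Fin.zero_le _) hne.symm

/-- Its colouring is `c`. -/
theorem soloInformed_hookColour_hookSigma :
    soloInformedHookColour (soloInformedHookSigma c hc) = c := by
  funext k
  obtain ⟨x, rfl⟩ : ∃ x, k = soloInformedCellPerm (soloInformedHookSigma c hc) x :=
    ⟨(soloInformedCellPerm (soloInformedHookSigma c hc)).symm k, (Equiv.apply_symm_apply _ k).symm⟩
  induction x using Fin.addCases with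
  | left j =>
    rw [soloInformed_hookColour_cellPerm_castAdd, soloInformed_cellPerm_hookSigma_apply,
      soloInformed_hookTau_castAdd c hc]
  | right j =>
    rw [soloInformed_hookColour_cellPerm_natAdd, soloInformed_cellPerm_hookSigma_apply,
      soloInformed_hookTau_natAdd c hc]

end Inverse

/-- **A linear extension of the hook poset is determined by its colouring.** -/
theorem soloInformed_eq_hookSigma {σ : Equiv.Perm (Fin (m + 1 + (i + 1)))}
    (hσ : soloInformedCompat (soloInformedHookPoset m i) σ)
    (hc : soloInformedCountC (soloInformedHookColour σ) = m + 1) :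
    σ = soloInformedHookSigma (soloInformedHookColour σ) hc := by
  obtain ⟨h1, h2, -⟩ := soloInformed_hookCompat_iff.1 hσ
  have key : soloInformedCellPerm σ = soloInformedHookTauPerm (soloInformedHookColour σ) hc := by
    refine Equiv.ext fun x => ?_
    rw [soloInformed_hookTauPerm_apply]
    induction x using Fin.addCases with
    | left j =>
      have hu := Finset.orderEmbOfFin_unique hc
        (f := fun j : Fin (m + 1) => soloInformedCellPerm σ (Fin.castAdd (i + 1) j))
        (fun j => Finset.mem_filter.2
          ⟨Finset.mem_univ _, soloInformed_hookColour_cellPerm_castAdd σ j⟩) h1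
      simp only [soloInformedHookTau, Fin.append_left]
      exact congrFun hu j
    | right j =>
      have hmono : StrictMono fun j' : Fin (i + 1) =>
          soloInformedCellPerm σ (Fin.natAdd (m + 1) (Fin.rev j')) :=
        fun a b hab => h2 (Fin.rev_lt_rev.2 hab)
      have hu := Finset.orderEmbOfFin_unique (soloInformed_hookCountC_not_of _ hc)
        (f := fun j' : Fin (i + 1) => soloInformedCellPerm σ (Fin.natAdd (m + 1) (Fin.rev j')))
        (fun j' => Finset.mem_filter.2
          ⟨Finset.mem_univ _, by simpa using soloInformed_hookColour_cellPerm_natAdd σ (Fin.rev j')⟩)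
        hmono
      simp only [soloInformedHookTau, Fin.append_right]
      have hj := congrFun hu (Fin.rev j)
      simp only [Fin.rev_rev] at hj
      exact hj
  calc σ = Fin.revPerm.trans (soloInformedCellPerm σ).symm :=
        soloInformed_eq_revPerm_trans_cellPerm_symm σ
    _ = Fin.revPerm.trans (soloInformedHookTauPerm (soloInformedHookColour σ) hc).symm := by rw [key]
    _ = soloInformedHookSigma (soloInformedHookColour σ) hc := rfl

end Summit.KontsevichZagierPeriods.KontsevichZagierPeriods.Theorems
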